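import Literature.Barriers.CriticalPhenomena.RigorousRGSmallParameterHHWThm22
import Literature.Barriers.CriticalPhenomena.RigorousRGSmallParameterHHWStripCert
import Literature.Barriers.CriticalPhenomena.RigorousRGSmallParameterHHWThm21Statement
import Literature.Barriers.CriticalPhenomena.RigorousRGSmallParameterHHWNewman
import HarnessLib

/-!
# Hara–Hattori–Watanabe 2001: the critical-mass strip (2.13) for `70 ≤ N < 100`, and Theorem 1.1 from the corrected Theorem 2.1

Hara–Hattori–Watanabe, *Triviality of hierarchical Ising model in four dimensions*, CMP 220 (2001)
13–40. The printed proof of Theorem 2.1 (§4, p. 14: "by induction on `N`, Proposition 4.3 implies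
…") uses, at the levels `N₀ ≤ N < N₁`, the bounds (4.7)–(4.8), which p. 11 derives from the
critical mass condition (2.13) `1 ≤ μ_{2,N} ≤ 1 + (3/√2)μ_{4,N}`; the statement grants only (2.17)
there. `RigorousRGSmallParameterHHWThm21Statement.lean` therefore vendors
`HaraHattoriWatanabe2001_thm21_corrected` = Theorem 2.1 with the extra hypothesis
`HierarchicalRG.Thm21StripHypothesis N₀ N₁` ((2.13) for `N₀ ≤ N < N₁` on the level-`N₁` window).
For the application (`N₀ = 70`, `N₁ = 100`, Theorem 2.2) that hypothesis is a finite computation of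
the same kind as Theorem 2.2, and this file PROVES it from Newman's bound (A.6)
(`HaraHattoriWatanabe2001_eqA6`, the one remaining analytic input of the tree's proof of Theorem
2.2, `HaraHattoriWatanabe2001_thm22_of_eqA6`):

* `Thm22Cert.Cfg.runG_sound` — Proposition 5.1 for the enclosure run started at a general rational
  point `s = num/den` (the tree's `step_sound`, iterated; cf. `run_sound` for `s = sNum/10¹⁶`);
* `Thm22Cert.Cfg.stripCheck_spec`, `exists_piece`, `piece_alg` — the meaning of the certificate
  `Thm22Cert.strip_cert_ok : cfg.stripCheck stripDen stripPts = true`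
  (`RigorousRGSmallParameterHHWStripCert.lean`: 15 runs at `t_0 < ⋯ < t_14` bracketing
  `[s̲₁₀₀, s̄₁₀₀]`, the lower half of (2.13) at `t_0`, the endpoint-mixed upper half on each piece);
* **`HierarchicalRG.thm21Strip_of_eqA6 : HaraHattoriWatanabe2001_eqA6 → Thm21StripHypothesis 70 100`**
  — by the monotonicity of every `a_{n,N}(s)` in `s` (`taylorA_traj_mono`, Griffiths), exactly as
  the paper's own passage from two points to an interval ((5.34));
* `HaraHattoriWatanabe2001_thm11_of_exists_critical` — the p. 6 argument "`μ_{4,N} → 0`,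
  `μ_{2,N} → 1` at some `s_c > 0` ⟹ Theorem 1.1" (the tree's `…thm11_of_parts` with (A.1) proved,
  `HaraHattoriWatanabe2001_eqA1_holds`), and the assemblies
  **`HaraHattoriWatanabe2001_thm11_of_thm21corrected`** (corrected Theorem 2.1 + Theorem 2.2 + the
  strip ⟹ Theorem 1.1) and **`HaraHattoriWatanabe2001_thm11_of_thm21corrected_of_eqA6`**
  (corrected Theorem 2.1 + (A.6) ⟹ Theorem 1.1).

So the trust base of `HaraHattoriWatanabe2001_thm11` is `{HaraHattoriWatanabe2001_thm21_corrected,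
HaraHattoriWatanabe2001_eqA6}` — the statement the printed §4 proves, and Newman's Proposition A.1
(the latter now a theorem of the tree, `HaraHattoriWatanabe2001_eqA6_holds` in
`…HHWNewmanBoundsProofs`; the unconditional forms are assembled downstream).

## References

* T. Hara, T. Hattori, H. Watanabe, Comm. Math. Phys. 220 (2001) 13–40: Theorem 1.1 and its proof
  (p. 6), Theorem 2.1, §2.3 (2.11)–(2.13), §4 (4.7)–(4.8), Proposition 5.1, §5.3 (5.30), (5.34),
  Appendix A (A.6).
-/

noncomputable section

namespace Literature.Barriers.CriticalPhenomena

open _root_.MeasureTheory _root_.ProbabilityTheory _root_.Filter _root_.Set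
open scoped _root_.Topology

namespace HierarchicalRG

namespace Thm22Cert

namespace Cfg

variable {C : Cfg}

/-! ### The run from a general rational point: soundness (Proposition 5.1) -/

/-- The initial values at `s = num/den`: `initLoG ≤ a_{n,0} 2^P ≤ initHiG`,
`a_{n,0} = n! s^{2n}/(2n)!` ((5.2)). [cite: HaraHattoriWatanabe2001, §5.1 eq. (5.2)] -/
theorem initG_sound (C : Cfg) (num : ℕ) {den : ℕ} (hden : 0 < den) (n : ℕ) :
    (C.initLoG num den n : ℝ) ≤ (n.factorial : ℝ) / (2 * n).factorial * ((num : ℝ) / den) ^ (2 * n) * C.one ∧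
    (n.factorial : ℝ) / (2 * n).factorial * ((num : ℝ) / den) ^ (2 * n) * C.one ≤ (C.initHiG num den n : ℝ) := by
  have hO := C.one_pos
  have hd : (den : ℝ) ≠ 0 := by exact_mod_cast hden.ne'
  have hpos : 0 < (2 * n).factorial * den ^ (2 * n) := Nat.mul_pos (Nat.factorial_pos _) (pow_pos hden _)
  have hval : (n.factorial : ℝ) / (2 * n).factorial * ((num : ℝ) / den) ^ (2 * n) * C.one =
      ((n.factorial * num ^ (2 * n) * C.one : ℕ) : ℝ) / (((2 * n).factorial * den ^ (2 * n) : ℕ) : ℝ) := by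
    push_cast
    rw [div_pow]
    field_simp
  unfold initLoG initHiG
  rw [hval]
  exact ⟨Nat.cast_div_le, div_le_cdiv _ hpos⟩

/-- The initial state at `s = num/den` encloses the initial values (5.2).
[cite: HaraHattoriWatanabe2001, §5.1 eq. (5.2)] -/
theorem initG_Encl (num : ℕ) {den : ℕ} (hden : 0 < den) {a0 : ℕ → ℝ}
    (ha : ∀ n, n ≤ C.M → a0 n = (n.factorial : ℝ) / (2 * n).factorial * ((num : ℝ) / den) ^ (2 * n)) :
    C.Encl (C.initG num den).1 (C.initG num den).2.1 a0 := by
  intro n hn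
  unfold initG
  simp only
  rw [get_map_range _ (by omega), get_map_range _ (by omega), ha n hn]
  exact C.initG_sound num hden n

/-- Flags propagate backwards along the run. [folklore] -/
theorem runG_flag_of_le {T : Tab} {num den : ℕ} {K : ℕ} (h : (C.runG T num den K).2.2 = true) :
    ∀ {N}, N ≤ K → (C.runG T num den N).2.2 = true := by
  induction K with
  | zero => intro N hN; have : N = 0 := by omega
            subst this; exact h
  | succ K ih =>
    intro N hN
    have hK : (C.runG T num den K).2.2 = true := (step_flag_sound h).1
    rcases Nat.lt_or_ge N (K + 1) with hlt | hge
    · exact ih hK (by omega)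
    · have : N = K + 1 := by omega
      subst this; exact h

/-- **Soundness of the run from `s = num/den` (Proposition 5.1).** For a family of Newman
sequences linked by the recursion (5.7) and starting at (5.2), every state of a run whose final
flag holds encloses the family. [cite: HaraHattoriWatanabe2001, Proposition 5.1] -/
theorem runG_sound (hs : C.sqrtOK = true) (hM : 1 ≤ C.M) {num den : ℕ} (hden : 0 < den) {a : ℕ → ℕ → ℝ}
    (hz : ∀ N, a N 0 = 1) (hnn : ∀ N n, 0 ≤ a N n) (hA6 : ∀ N m n, a N (m + n) ≤ a N m * a N n) {K : ℕ}
    (hrec : ∀ N n, N < K → n ≤ C.M → a (N + 1) n =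
      (∑' m, ((beta (Real.sqrt 2) / 2) ^ m * bOf (a N) (m + n) * tildeCoef m n)) /
        (∑' m, ((beta (Real.sqrt 2) / 2) ^ m * bOf (a N) (m + 0) * tildeCoef m 0)))
    (h0 : ∀ n, n ≤ C.M → a 0 n = (n.factorial : ℝ) / (2 * n).factorial * ((num : ℝ) / den) ^ (2 * n))
    (hflag : (C.runG C.mkTab num den K).2.2 = true) :
    ∀ N, N ≤ K → C.Encl (C.runG C.mkTab num den N).1 (C.runG C.mkTab num den N).2.1 (a N) := by
  intro N
  induction N with
  | zero => intro _; exact initG_Encl num hden h0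
  | succ N ih =>
    intro hN
    have hE := ih (by omega)
    have hf : (C.runG C.mkTab num den (N + 1)).2.2 = true := runG_flag_of_le hflag hN
    exact step_sound hs hM hE (hz N) (hnn N) (hA6 N) (fun n hn => hrec N n (by omega) hn) hf

/-- `histG` lists the run, latest first. [folklore] -/
theorem histG_eq (T : Tab) (num den k : ℕ) :
    C.histG T num den k = ((List.range (k + 1)).reverse).map (C.runG T num den) := by
  induction k with
  | zero => rfl
  | succ k ih =>
    have e : ∀ j, ((List.range (j + 1)).reverse).map (C.runG T num den) =
        C.runG T num den j :: ((List.range j).reverse).map (C.runG T num den) := by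
      intro j; simp [List.range_succ]
    rw [histG, ih, e, e, e]
    rfl

/-- Reading the history: the state at step `N ≤ nSteps` is `runG N`. [folklore] -/
theorem stateAt_histG (T : Tab) (num den : ℕ) {N : ℕ} (hN : N ≤ C.nSteps) :
    C.stateAt (C.histG T num den C.nSteps) N = C.runG T num den N := by
  unfold stateAt
  have hlen : C.nSteps - N < (List.range (C.nSteps + 1)).length := by
    simp only [List.length_range]; omega
  rw [histG_eq, List.getD_eq_getElem?_getD, List.getElem?_map, List.getElem?_reverse hlen]
  have e : (List.range (C.nSteps + 1)).length - 1 - (C.nSteps - N) = N := by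
    simp only [List.length_range]; omega
  rw [e, List.getElem?_range (by omega)]
  rfl

/-! ### What `stripCheck = true` says -/

/-- Unpacking `stripCheck = true`. [folklore] -/
theorem stripCheck_spec {den : ℕ} {ts : List ℕ} (h : C.stripCheck den ts = true) :
    C.sqrtOK = true ∧ 2 ≤ C.M ∧ C.N0 ≤ C.nSteps ∧ 0 < den ∧ 2 ≤ ts.length ∧ sortedOK ts = true ∧
    (∀ num ∈ ts, (C.stateAt (C.histG C.mkTab num den C.nSteps) C.nSteps).2.2 = true) ∧
    C.stripBelowOK (C.histG C.mkTab (headD0 ts) den C.nSteps) = true ∧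
    C.stripAboveOK (C.histG C.mkTab (lastD ts) den C.nSteps) = true ∧
    C.stripLowOK (C.histG C.mkTab (headD0 ts) den C.nSteps) = true ∧
    C.stripPiecesOK (ts.map fun num => C.histG C.mkTab num den C.nSteps) = true := by
  unfold stripCheck at h
  simp only [Bool.and_eq_true, decide_eq_true_eq, List.all_eq_true] at h
  obtain ⟨⟨⟨⟨⟨⟨⟨⟨⟨⟨hs, hM⟩, hN⟩, hd⟩, hl⟩, hsort⟩, hfl⟩, hb⟩, ha⟩, hlow⟩, hp⟩ := h
  refine ⟨hs, hM, hN, hd, hl, hsort, fun num hnum => ?_, hb, ha, hlow, hp⟩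
  exact hfl _ (List.mem_map.2 ⟨num, hnum, rfl⟩)

/-- Locating the piece: for sorted points with all consecutive piece checks, every `x` between the
first and the last point lies in some checked piece `[a, b]`. [folklore] -/
theorem exists_piece (H : ℕ → List State) :
    ∀ ts : List ℕ, sortedOK ts = true → C.stripPiecesOK (ts.map H) = true → 2 ≤ ts.length →
      ∀ x : ℝ, ((headD0 ts : ℕ) : ℝ) ≤ x → x ≤ ((lastD ts : ℕ) : ℝ) →
      ∃ a b : ℕ, a ∈ ts ∧ b ∈ ts ∧ (a : ℝ) ≤ x ∧ x ≤ (b : ℝ) ∧ C.stripPieceOK (H a) (H b) = true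
  | [] => by intro _ _ hl; simp at hl
  | [_] => by intro _ _ hl; simp at hl
  | a :: b :: rest => by
    intro hsort hP _ x hax hxl
    have hsort' : a ≤ b ∧ sortedOK (b :: rest) = true := by
      simpa [sortedOK] using hsort
    have hP' : C.stripPieceOK (H a) (H b) = true ∧ C.stripPiecesOK ((b :: rest).map H) = true := by
      simpa [stripPiecesOK] using hP
    have hax' : (a : ℝ) ≤ x := by simpa [headD0] using hax
    by_cases hxb : x ≤ b
    · exact ⟨a, b, by simp, by simp, hax', hxb, hP'.1⟩
    · push Not at hxb
      cases rest with
      | nil =>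
        have : x ≤ (b : ℝ) := by simpa [lastD] using hxl
        exact absurd this (not_le.2 hxb)
      | cons c rest' =>
        have hxl' : x ≤ ((lastD (b :: c :: rest') : ℕ) : ℝ) := by simpa [lastD] using hxl
        obtain ⟨a', b', ha', hb', h1, h2, h3⟩ :=
          exists_piece H (b :: c :: rest') hsort'.2 hP'.2 (by simp) x (by simpa [headD0] using hxb.le) hxl'
        exact ⟨a', b', List.mem_cons_of_mem _ ha', List.mem_cons_of_mem _ hb', h1, h2, h3⟩

/-- The first point belongs to the list (two or more points). [folklore] -/
theorem headD0_mem : ∀ {ts : List ℕ}, 2 ≤ ts.length → headD0 ts ∈ ts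
  | [], h => by simp at h
  | a :: _, _ => by simp [headD0]

/-- The last point belongs to the list (two or more points). [folklore] -/
theorem lastD_mem : ∀ {ts : List ℕ}, 1 ≤ ts.length → lastD ts ∈ ts
  | [], h => by simp at h
  | [a], _ => by simp [lastD]
  | a :: b :: rest, _ => by
    have := lastD_mem (ts := b :: rest) (by simp)
    simpa [lastD] using List.mem_cons_of_mem a this

/-- The first point is below the last (sorted, two or more points). [folklore] -/
theorem headD0_le_lastD : ∀ {ts : List ℕ}, sortedOK ts = true → headD0 ts ≤ lastD ts
  | [], _ => le_rfl
  | [a], _ => le_rfl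
  | a :: b :: rest, h => by
    have h' : a ≤ b ∧ sortedOK (b :: rest) = true := by simpa [sortedOK] using h
    have := headD0_le_lastD h'.2
    simp only [headD0, lastD] at this ⊢
    exact h'.1.trans this

/-- The algebra of one piece: from the integer inequalities of `stripPieceOK` (scaled by `O = 2^P`,
`√2` rounded down to `s2L/O`) and the endpoint enclosures, the upper half of (2.13) for every
`x₁ ∈ [L1, H1]/O`, `x₂ ≤ H2/O`. [cite: HaraHattoriWatanabe2001, §2.3 eq. (2.13) and §5.3 eq. (5.34)] -/
theorem piece_alg {O s2L r L1 H1 H2 x1 x2 : ℝ} (hO : 0 < O) (hL1 : 0 ≤ L1) (hs2L : 0 ≤ s2L)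
    (hr : 3 * s2L / (2 * O) ≤ r)
    (c1 : H2 * O ≤ L1 * L1) (c2 : 4 * O ^ 2 * H1 ≤ 4 * O ^ 3 + 3 * s2L * (L1 * L1 - H2 * O))
    (e1 : L1 ≤ x1 * O) (e2 : x1 * O ≤ H1) (e3 : x2 * O ≤ H2) :
    x1 ≤ 1 + r * ((x1 ^ 2 - x2) / 2) := by
  have hx1O : 0 ≤ x1 * O := hL1.trans e1
  have hx1 : 0 ≤ x1 := nonneg_of_mul_nonneg_left hx1O hO
  have hsq : L1 * L1 ≤ (x1 * O) * (x1 * O) := mul_self_le_mul_self hL1 e1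
  have hx2 : x2 * O * O ≤ H2 * O := mul_le_mul_of_nonneg_right e3 hO.le
  have hY : L1 * L1 - H2 * O ≤ (x1 ^ 2 - x2) * O ^ 2 := by nlinarith
  have hYnn : 0 ≤ L1 * L1 - H2 * O := by linarith
  have hq : 0 ≤ (x1 ^ 2 - x2) / 2 := by
    have : 0 ≤ (x1 ^ 2 - x2) * O ^ 2 := hYnn.trans hY
    have hO2 : 0 < O ^ 2 := by positivity
    have := nonneg_of_mul_nonneg_left this hO2
    linarith
  have step1 : x1 ≤ H1 / O := by rw [le_div_iff₀ hO]; exact e2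
  have step2 : H1 / O ≤ 1 + 3 * s2L * (L1 * L1 - H2 * O) / (4 * O ^ 3) := by
    rw [div_le_iff₀ hO]
    have e : (1 + 3 * s2L * (L1 * L1 - H2 * O) / (4 * O ^ 3)) * O =
        (4 * O ^ 3 + 3 * s2L * (L1 * L1 - H2 * O)) / (4 * O ^ 2) := by
      field_simp
    rw [e, le_div_iff₀ (by positivity)]
    linarith
  have step3 : 3 * s2L * (L1 * L1 - H2 * O) / (4 * O ^ 3) ≤ 3 * s2L / (2 * O) * ((x1 ^ 2 - x2) / 2) := by
    rw [div_mul_div_comm, show 2 * O * 2 = 4 * O by ring, div_le_div_iff₀ (by positivity) (by positivity)]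
    have h3 : 3 * s2L * (L1 * L1 - H2 * O) ≤ 3 * s2L * ((x1 ^ 2 - x2) * O ^ 2) :=
      mul_le_mul_of_nonneg_left hY (by positivity)
    nlinarith
  have step4 : 3 * s2L / (2 * O) * ((x1 ^ 2 - x2) / 2) ≤ r * ((x1 ^ 2 - x2) / 2) :=
    mul_le_mul_of_nonneg_right hr hq
  linarith

/-- The algebra of the upper bracket ((5.30) at the top point): from the integer inequalities of
`stripAboveOK` and the enclosure at `N₁`, `1 + (3/√2)(a₁² - a₂)/2 < a₁` (`√2` rounded up).
[cite: HaraHattoriWatanabe2001, §5.3 eq. (5.30)] -/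
theorem above_alg {O s2H r lp1 lp2 hp1 a1 a2 : ℝ} (hO : 0 < O) (ha1 : 0 ≤ a1) (hr0 : 0 ≤ r)
    (hr : r ≤ 3 * s2H / (2 * O))
    (c3 : lp2 * O ≤ hp1 * hp1) (c4 : 4 * O ^ 3 + 3 * s2H * (hp1 * hp1) < 4 * O ^ 2 * lp1 + 3 * s2H * lp2 * O)
    (hl1 : lp1 ≤ a1 * O) (hu1 : a1 * O ≤ hp1) (hl2 : lp2 ≤ a2 * O) :
    1 + r * ((a1 ^ 2 - a2) / 2) < a1 := by
  have hsq : (a1 * O) * (a1 * O) ≤ hp1 * hp1 := mul_self_le_mul_self (by positivity) hu1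
  have hmu : (a1 ^ 2 - a2) / 2 ≤ (hp1 * hp1 - lp2 * O) / (2 * O ^ 2) := by
    rw [div_le_div_iff₀ (by norm_num) (by positivity)]
    have t : lp2 * O ≤ a2 * O * O := mul_le_mul_of_nonneg_right hl2 hO.le
    nlinarith [hsq, t]
  have hmubar : 0 ≤ (hp1 * hp1 - lp2 * O) / (2 * O ^ 2) := by
    apply div_nonneg _ (by positivity); linarith
  calc 1 + r * ((a1 ^ 2 - a2) / 2)
      ≤ 1 + r * ((hp1 * hp1 - lp2 * O) / (2 * O ^ 2)) := by gcongr
    _ ≤ 1 + 3 * s2H / (2 * O) * ((hp1 * hp1 - lp2 * O) / (2 * O ^ 2)) := by gcongr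
    _ < lp1 / O := by
        rw [div_mul_div_comm, ← sub_pos]
        have e : lp1 / O - (1 + 3 * s2H * (hp1 * hp1 - lp2 * O) / (2 * O * (2 * O ^ 2))) =
            (4 * O ^ 2 * lp1 + 3 * s2H * lp2 * O - (4 * O ^ 3 + 3 * s2H * (hp1 * hp1))) / (4 * O ^ 3) := by
          field_simp; ring
        rw [e]; exact div_pos (by linarith) (by positivity)
    _ ≤ a1 := by rw [div_le_iff₀ hO]; exact hl1

end Cfg

end Thm22Cert

open Thm22Cert

/-- **The critical-mass strip for `N₀ = 70`, `N₁ = 100`, PROVED from Newman's bound (A.6)**: for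
every `s ∈ [s̲₁₀₀, s̄₁₀₀]` and every `70 ≤ N < 100`, `1 ≤ μ_{2,N} ≤ 1 + (3/√2)μ_{4,N}` — the
hypothesis `Thm21StripHypothesis 70 100` of `HaraHattoriWatanabe2001_thm21_corrected`, by the
certificate `strip_cert_ok` (Proposition 5.1 enclosures at 15 points bracketing the window), the
window characterisations (2.11)–(2.12) and the monotonicity of `a_{n,N}(s)` in `s`.
[cite: HaraHattoriWatanabe2001, §2.3 eqs. (2.11)–(2.13), Proposition 5.1 and §5.3 eqs. (5.30), (5.34)] -/
theorem thm21Strip_of_eqA6 (hA6 : HaraHattoriWatanabe2001_eqA6) : Thm21StripHypothesis 70 100 := by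
  obtain ⟨hs, hM2, -, hden, hlen, hsort, hflags, hbelow, habove, hlow, hpieces⟩ :=
    Cfg.stripCheck_spec strip_cert_ok
  obtain ⟨hs1, hs2, hs3⟩ := cfg.sqrtOK_sound hs
  have hO := cfg.one_pos
  set O : ℝ := (cfg.one : ℝ) with hOdef
  set den : ℕ := stripDen with hden_def
  set ts : List ℕ := stripPts with hts_def
  have hdenR : (0 : ℝ) < (den : ℝ) := by exact_mod_cast hden
  have h100 : cfg.nSteps = 100 := rfl
  have h70 : cfg.N0 = 70 := rfl
  -- monotonicity transport
  have mono : ∀ {s t : ℝ}, 0 ≤ s → s ≤ t → ∀ N n, taylorA (traj s N) n ≤ taylorA (traj t N) n :=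
    fun hs hst N n => taylorA_traj_mono N n hs (hs.trans hst) hst
  -- enclosures at the listed points (Proposition 5.1 + the flags)
  have E : ∀ num ∈ ts, ∀ N, N ≤ 100 →
      cfg.Encl (cfg.runG cfg.mkTab num den N).1 (cfg.runG cfg.mkTab num den N).2.1
        (fun n => taylorA (traj ((num : ℝ) / den) N) n) := by
    intro num hnum N hN
    have hflag := hflags num hnum
    rw [Cfg.stateAt_histG _ _ _ le_rfl] at hflag
    have hs0 : (0 : ℝ) ≤ (num : ℝ) / den := by positivity
    exact Cfg.runG_sound hs (by omega) hden (a := fun N n => taylorA (traj ((num : ℝ) / den) N) n)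
      (fun N => taylorA_zero _) (fun N n => taylorA_nonneg _ _) (fun N m n => hA6 _ hs0 N m n)
      (K := cfg.nSteps) (fun N n _ _ => taylorA_traj_succ_tsum _ N n) (fun n _ => taylorA_traj_init _ n)
      hflag N hN
  -- the two extreme points
  set a : ℕ := headD0 ts with ha_def
  set b : ℕ := lastD ts with hb_def
  have ha_mem : a ∈ ts := Cfg.headD0_mem hlen
  have hb_mem : b ∈ ts := Cfg.lastD_mem (by omega)
  have hab : a ≤ b := Cfg.headD0_le_lastD hsort
  have ha_pos : 0 < a := by rw [ha_def, hts_def]; decide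
  have haR : (0 : ℝ) < (a : ℝ) / den := by positivity
  have hbR : (0 : ℝ) < (b : ℝ) / den := div_pos (by exact_mod_cast ha_pos.trans_le hab) hdenR
  -- `t_0` is below the window: `μ_{2,100}(a/den) < 1`
  have hbelow' : taylorA (traj ((a : ℝ) / den) 100) 1 < 1 := by
    unfold Cfg.stripBelowOK at hbelow
    simp only [decide_eq_true_eq] at hbelow
    rw [Cfg.stateAt_histG _ _ _ le_rfl] at hbelow
    have hup := ((E a ha_mem 100 le_rfl) 1 (by omega)).2
    have : (get (cfg.runG cfg.mkTab a den 100).2.1 1 : ℝ) < O := by rw [hOdef]; exact_mod_cast hbelow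
    have h3 : taylorA (traj ((a : ℝ) / den) 100) 1 * O < 1 * O := by simp only at hup; linarith
    exact lt_of_mul_lt_mul_right h3 hO.le
  -- `t_K` is above the window: `μ_{2,100}(b/den) > 1 + (3/√2) μ_{4,100}(b/den)`
  have habove' : 1 + 3 / Real.sqrt 2 * mu4 (traj ((b : ℝ) / den) 100) < mu2 (traj ((b : ℝ) / den) 100) := by
    unfold Cfg.stripAboveOK at habove
    simp only [decide_eq_true_eq] at habove
    rw [Cfg.stateAt_histG _ _ _ le_rfl] at habove
    obtain ⟨-, c3, c4⟩ := habove
    obtain ⟨hl1, hu1⟩ := (E b hb_mem 100 le_rfl) 1 (by omega)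
    obtain ⟨hl2, -⟩ := (E b hb_mem 100 le_rfl) 2 (by omega)
    simp only at hl1 hu1 hl2
    have hcoef : 3 / Real.sqrt 2 ≤ 3 * cfg.s2H / (2 * O) := by
      rw [Cfg.three_div_sqrt_two, div_le_div_iff₀ (by norm_num) (by positivity)]
      have : 3 * Real.sqrt 2 * (2 * O) = 3 * 2 * (Real.sqrt 2 * O) := by ring
      rw [this]; rw [hOdef]; linarith
    have c3r : (get (cfg.runG cfg.mkTab b den 100).1 2 : ℝ) * O ≤
        (get (cfg.runG cfg.mkTab b den 100).2.1 1 : ℝ) * get (cfg.runG cfg.mkTab b den 100).2.1 1 := by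
      rw [hOdef]; exact_mod_cast c3
    have c4r : 4 * O ^ 3 + 3 * cfg.s2H * ((get (cfg.runG cfg.mkTab b den 100).2.1 1 : ℝ) *
          get (cfg.runG cfg.mkTab b den 100).2.1 1) <
        4 * O ^ 2 * (get (cfg.runG cfg.mkTab b den 100).1 1 : ℝ) +
          3 * cfg.s2H * (get (cfg.runG cfg.mkTab b den 100).1 2 : ℝ) * O := by
      rw [hOdef]; exact_mod_cast c4
    exact Cfg.above_alg hO (taylorA_nonneg _ 1) (by positivity) hcoef c3r c4r hl1 hu1 hl2
  -- the window lies inside `[a/den, b/den]`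
  have hlowW : (a : ℝ) / den ≤ sLow 100 := by
    refine le_csInf ⟨(b : ℝ) / den, hbR, ?_⟩ fun s hs' => ?_
    · show 1 ≤ mu2 (traj ((b : ℝ) / den) 100)
      have h4 : 0 ≤ 3 / Real.sqrt 2 * mu4 (traj ((b : ℝ) / den) 100) := by
        have : 0 ≤ mu4 (traj ((b : ℝ) / den) 100) := by
          -- from the certificate: `lp2 * O ≤ hp1²` is not needed; use Newman (A.6): a₂ ≤ a₁²
          have := hA6 _ hbR.le 100 1 1
          simp only [mu4]
          nlinarith
        positivity
      linarith
    · obtain ⟨hs0, hs1'⟩ := hs'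
      change 1 ≤ taylorA (traj s 100) 1 at hs1'
      by_contra hlt
      push Not at hlt
      have := mono hs0.le hlt.le 100 1
      linarith
  have hupW : sUp 100 ≤ (b : ℝ) / den :=
    csInf_le ⟨0, fun s hs' => hs'.1.le⟩ ⟨hbR, (min_le_left _ _).trans habove'.le⟩
  -- the strip
  intro s hsI N hN1 hN2
  have hsa : (a : ℝ) / den ≤ s := hlowW.trans hsI.1
  have hsb : s ≤ (b : ℝ) / den := hsI.2.trans hupW
  have hs0 : 0 ≤ s := haR.le.trans hsa
  have hN100 : N ≤ 100 := hN2.le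
  constructor
  · -- lower half from `t_0`
    unfold Cfg.stripLowOK at hlow
    simp only [List.all_eq_true, List.mem_range, decide_eq_true_eq, h100, h70] at hlow
    have h := hlow (N - 70) (by omega)
    rw [show 70 + (N - 70) = N by omega] at h
    rw [show cfg.stateAt (cfg.histG cfg.mkTab a den 100) N = cfg.runG cfg.mkTab a den N from
      Cfg.stateAt_histG _ _ _ hN100] at h
    have hl := ((E a ha_mem N hN100) 1 (by omega)).1
    simp only at hl
    have hR : O ≤ taylorA (traj ((a : ℝ) / den) N) 1 * O := by
      refine le_trans ?_ hl
      rw [hOdef]; exact_mod_cast h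
    have h1 : 1 ≤ taylorA (traj ((a : ℝ) / den) N) 1 := by
      by_contra hlt; push Not at hlt; nlinarith
    exact h1.trans (mono haR.le hsa N 1)
  · -- upper half from the piece containing `s`
    have hx1 : ((headD0 ts : ℕ) : ℝ) ≤ s * den := by
      rw [← ha_def]; rwa [div_le_iff₀ hdenR] at hsa
    have hx2 : s * den ≤ ((lastD ts : ℕ) : ℝ) := by
      rw [← hb_def]; rwa [le_div_iff₀ hdenR] at hsb
    obtain ⟨u, v, hu, hv, hux, hxv, hpc⟩ :=
      Cfg.exists_piece (fun num => cfg.histG cfg.mkTab num den cfg.nSteps) ts hsort hpieces hlen _ hx1 hx2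
    have hus : (u : ℝ) / den ≤ s := by rwa [div_le_iff₀ hdenR]
    have hsv : s ≤ (v : ℝ) / den := by rwa [le_div_iff₀ hdenR]
    have hu0 : (0 : ℝ) ≤ (u : ℝ) / den := by positivity
    unfold Cfg.stripPieceOK at hpc
    simp only [List.all_eq_true, List.mem_range, decide_eq_true_eq, h100, h70] at hpc
    obtain ⟨c1, c2⟩ := hpc (N - 70) (by omega)
    rw [show 70 + (N - 70) = N by omega] at c1 c2
    rw [show cfg.stateAt (cfg.histG cfg.mkTab u den 100) N = cfg.runG cfg.mkTab u den N from
      Cfg.stateAt_histG _ _ _ hN100,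
      show cfg.stateAt (cfg.histG cfg.mkTab v den 100) N = cfg.runG cfg.mkTab v den N from
      Cfg.stateAt_histG _ _ _ hN100] at c1 c2
    set L1 : ℕ := get (cfg.runG cfg.mkTab u den N).1 1 with hL1
    set H1 : ℕ := get (cfg.runG cfg.mkTab v den N).2.1 1 with hH1
    set H2 : ℕ := get (cfg.runG cfg.mkTab v den N).2.1 2 with hH2
    have c1r : (H2 : ℝ) * O ≤ (L1 : ℝ) * L1 := by rw [hOdef]; exact_mod_cast c1
    have c2r : 4 * O ^ 2 * (H1 : ℝ) ≤ 4 * O ^ 3 + 3 * cfg.s2L * ((L1 : ℝ) * L1 - H2 * O) := by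
      have : ((L1 * L1 - H2 * cfg.one : ℕ) : ℝ) = (L1 : ℝ) * L1 - H2 * O := by
        rw [hOdef]; push_cast [Nat.cast_sub c1]; ring
      rw [← this, hOdef]; exact_mod_cast c2
    have eL := ((E u hu N hN100) 1 (by omega)).1
    have eH1 := ((E v hv N hN100) 1 (by omega)).2
    have eH2 := ((E v hv N hN100) 2 (by omega)).2
    simp only at eL eH1 eH2
    rw [← hL1] at eL; rw [← hH1] at eH1; rw [← hH2] at eH2
    have m1 := mono hu0 hus N 1
    have m2 := mono hs0 hsv N 1
    have m3 := mono hs0 hsv N 2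
    have hcoef : 3 * cfg.s2L / (2 * O) ≤ 3 / Real.sqrt 2 := by
      rw [Cfg.three_div_sqrt_two, div_le_div_iff₀ (by positivity) (by norm_num)]
      rw [hOdef]; nlinarith
    show taylorA (traj s N) 1 ≤ 1 + 3 / Real.sqrt 2 * ((taylorA (traj s N) 1 ^ 2 - taylorA (traj s N) 2) / 2)
    refine Cfg.piece_alg hO (by positivity) (by positivity) hcoef c1r c2r ?_ ?_ ?_
    · exact eL.trans (mul_le_mul_of_nonneg_right m1 hO.le)
    · exact (mul_le_mul_of_nonneg_right m2 hO.le).trans eH1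
    · exact (mul_le_mul_of_nonneg_right m3 hO.le).trans eH2

end HierarchicalRG

open HierarchicalRG

/-- **The p. 6 argument, parametrised by the critical point**: if at some `s_c > 0` the truncated
correlations satisfy `μ_{4,N} → 0` and `μ_{2,N} → 1`, then Theorem 1.1 holds (with (A.1) proved,
`HaraHattoriWatanabe2001_eqA1_holds`: `ĥ_N(ξ) → e^{-ξ²}`, then Lévy's continuity theorem).
[cite: HaraHattoriWatanabe2001, §2.3 "Proof of Theorem 1.1 for d = 4" (p. 6)] -/
theorem HaraHattoriWatanabe2001_thm11_of_exists_critical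
    (h : ∃ s_c : ℝ, 0 < s_c ∧ Tendsto (fun N => mu4 (traj s_c N)) atTop (𝓝 0) ∧
      Tendsto (fun N => mu2 (traj s_c N)) atTop (𝓝 1)) :
    HaraHattoriWatanabe2001_thm11 := by
  obtain ⟨s_c, hs_pos, h4, h2⟩ := h
  refine ⟨s_c, hs_pos, fun g => ?_⟩
  let μs : ℕ → ProbabilityMeasure ℝ := fun N => ⟨traj s_c N, inferInstance⟩
  let μ0 : ProbabilityMeasure ℝ := ⟨gaussianReal 0 2, inferInstance⟩
  have hconv : Tendsto μs atTop (𝓝 μ0) := by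
    apply ProbabilityMeasure.tendsto_of_tendsto_charFun
    intro t
    have hc := tendsto_charFun_traj HaraHattoriWatanabe2001_eqA1_holds hs_pos.le h2 h4 t
    have e : charFun (μ0 : Measure ℝ) t = ((Real.exp (-t ^ 2) : ℝ) : ℂ) := by
      change charFun (gaussianReal 0 2) t = _
      rw [charFun_gaussianReal]
      push_cast
      congr 1
      ring
    rw [e]
    exact hc
  exact (ProbabilityMeasure.tendsto_iff_forall_integral_tendsto.1 hconv) g

/-- **Theorem 1.1 from the corrected Theorem 2.1, Theorem 2.2 and the strip.**
[cite: HaraHattoriWatanabe2001, Theorem 1.1, §2.3 (p. 6), Theorem 2.1 and Theorem 2.2] -/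
theorem HaraHattoriWatanabe2001_thm11_of_thm21corrected (h21 : HaraHattoriWatanabe2001_thm21_corrected)
    (h22 : HaraHattoriWatanabe2001_thm22) (hstrip : Thm21StripHypothesis 70 100) :
    HaraHattoriWatanabe2001_thm11 := by
  obtain ⟨hhyp, hlow, -⟩ := h22
  obtain ⟨s_c, ⟨hsc1, -⟩, h4, h2⟩ := h21 70 100 (by norm_num) hhyp hstrip
  have hs_pos : 0 < s_c := lt_of_lt_of_le (by norm_num) (hlow.trans hsc1)
  exact HaraHattoriWatanabe2001_thm11_of_exists_critical ⟨s_c, hs_pos, h4, h2⟩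

/-- **Theorem 1.1 from the corrected Theorem 2.1 and Newman's bound (A.6)** — Theorem 2.2
(`HaraHattoriWatanabe2001_thm22_of_eqA6`) and the strip (`thm21Strip_of_eqA6`) being computed. The
trust base of `HaraHattoriWatanabe2001_thm11` is thus
`{HaraHattoriWatanabe2001_thm21_corrected, HaraHattoriWatanabe2001_eqA6}`.
[cite: HaraHattoriWatanabe2001, Theorem 1.1, Theorems 2.1–2.2 and Appendix A (A.6)] -/
theorem HaraHattoriWatanabe2001_thm11_of_thm21corrected_of_eqA6
    (h21 : HaraHattoriWatanabe2001_thm21_corrected) (hA6 : HaraHattoriWatanabe2001_eqA6) :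
    HaraHattoriWatanabe2001_thm11 :=
  HaraHattoriWatanabe2001_thm11_of_thm21corrected h21 (HaraHattoriWatanabe2001_thm22_of_eqA6 hA6)
    (thm21Strip_of_eqA6 hA6)

end Literature.Barriers.CriticalPhenomena

end
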